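import Literature.MathematicalPhysics.QuantumLattice.InfVolFermionStateBounds
import Literature.MathematicalPhysics.QuantumLattice.FermionicPEPS
import Literature.MathematicalPhysics.QuantumLattice.HubbardWave0RepulsiveProofs
import Literature.MathematicalPhysics.QuantumLattice.HubbardModelThermodynamicLimitProofs
import Literature.MathematicalPhysics.QuantumLattice.HubbardAtomicLimit
import HarnessLib

/-!
# The energy of a state is at least its number distribution's worth of sector ground energies

Topic `Literature/MathematicalPhysics/QuantumLattice`; namespace
`Literature.MathematicalPhysics.QuantumLattice` (the file path). For a finite ordered orbital set,
the Hubbard Hamiltonian `H = hamiltonian G t U` of a graph `G` conserves the particle number, and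
for every particle number `N` it is bounded below on the `N`-particle sector by the sector ground
energy `E_G(N) = groundEnergyAt G t U N` (the infimum of the Rayleigh quotient). Consequently the
operator `H - Σ_N E_G(N) P_N` (`P_N = numberProj N`, the projection on the `N`-particle sector) is
positive semidefinite, and every infinite-volume state `ω` of the lattice fermion system (indeed
any positive normalised functional) satisfies, on the local algebra of a region `Λ`,
`Re ω(H) ≥ Σ_N Re ω(P_N) · E_G(N)`, with the number distribution `p_N = Re ω(P_N) ≥ 0`,
`Σ_N p_N = 1`, `Σ_N N p_N = Re ω(N_Λ)`. Everything is PROVED; no definition, no named fact.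

## Results

* `re_dotProduct_hamiltonian_mulVec_ge`: `Re⟨φ, Hφ⟩ ≥ E_G(N) · Re⟨φ, φ⟩` for `N`-particle `φ`.
* `posSemidef_hamiltonian_sub_sum_groundEnergyAt_smul_numberProj`:
  `H - Σ_{N ≤ 2|Λ|} E_G(N) P_N` is positive semidefinite.
* `InfVolFermionState.sum_re_expect_numberProj_mul_groundEnergyAt_le`:
  `Σ_{N ≤ 2|Λ|} Re ω(P_N) E_G(N) ≤ Re ω(H)`.
* `InfVolFermionState.re_expect_numberProj_nonneg`, `.sum_re_expect_numberProj`,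
  `.sum_mul_re_expect_numberProj`: `p_N ≥ 0`, `Σ p_N = 1`, `Σ N p_N = Re ω(totalNumber)`.

Standard (Ruelle, *Statistical Mechanics* (1969) §2.4, variational principle in finite volume;
Bratteli–Robinson II §6.2.4).
-/

noncomputable section

namespace Literature.MathematicalPhysics.QuantumLattice

open Matrix Finset HubbardWave0 Literature.Probability.LatticeModels
open scoped ComplexOrder

/-! ### Finite-volume: sectors and the variational bound -/

section Finite

variable {Λ : Type*} [LinearOrder Λ] [Fintype Λ]

/-- **The Rayleigh bound without normalisation**: for an `N`-particle vector `φ`,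
`E_G(N) · Re⟨φ, φ⟩ ≤ Re⟨φ, H φ⟩`. [folklore] -/
theorem re_dotProduct_hamiltonian_mulVec_ge (G : SimpleGraph Λ) [DecidableRel G.Adj] (t U : ℝ) {N : ℕ}
    {φ : Fock (Orb Λ)} (hφ : IsNParticle N φ) :
    groundEnergyAt G t U N * (star φ ⬝ᵥ φ).re ≤ (star φ ⬝ᵥ (hamiltonian G t U *ᵥ φ)).re := by
  by_cases h0 : φ = 0
  · subst h0; simp
  obtain ⟨c, hc0, hc1⟩ := exists_smul_unit h0
  have hN : IsNParticle N (c • φ) := fun s hs => by rw [Pi.smul_apply, hφ s hs, smul_zero]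
  have hE := ThermodynamicLimit.groundEnergy_le_re_expect (hamiltonian G t U) hN hc1
  have hcc : star c * c = ((‖c‖ ^ 2 : ℝ) : ℂ) := by
    rw [Complex.star_def, Complex.conj_mul', Complex.ofReal_pow]
  have hexp : expect (hamiltonian G t U) (c • φ) = ((‖c‖ ^ 2 : ℝ) : ℂ) * (star φ ⬝ᵥ (hamiltonian G t U *ᵥ φ)) := by
    rw [expect, star_smul, mulVec_smul, smul_dotProduct, dotProduct_smul, smul_smul, hcc, smul_eq_mul]
  have hnorm : ((‖c‖ ^ 2 : ℝ) : ℂ) * (star φ ⬝ᵥ φ) = 1 := by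
    rw [← hc1, star_smul, smul_dotProduct, dotProduct_smul, smul_smul, hcc, smul_eq_mul]
  have hnorm' : ‖c‖ ^ 2 * (star φ ⬝ᵥ φ).re = 1 := by
    have := congrArg Complex.re hnorm
    rwa [Complex.re_ofReal_mul, Complex.one_re] at this
  rw [hexp, Complex.re_ofReal_mul] at hE
  have hpos : 0 ≤ (star φ ⬝ᵥ φ).re := (Complex.nonneg_iff.1 (dotProduct_star_self_nonneg φ)).1
  calc groundEnergyAt G t U N * (star φ ⬝ᵥ φ).re
      ≤ (‖c‖ ^ 2 * (star φ ⬝ᵥ (hamiltonian G t U *ᵥ φ)).re) * (star φ ⬝ᵥ φ).re :=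
        mul_le_mul_of_nonneg_right hE hpos
    _ = (star φ ⬝ᵥ (hamiltonian G t U *ᵥ φ)).re * (‖c‖ ^ 2 * (star φ ⬝ᵥ φ).re) := by ring
    _ = _ := by rw [hnorm', mul_one]

/-- `⟨ψ, P_N ψ⟩ = ⟨P_N ψ, P_N ψ⟩` (`P_N` is an orthogonal projection). [folklore] -/
theorem dotProduct_numberProj_mulVec {ι : Type*} [DecidableEq ι] [Fintype ι] (N : ℕ) (ψ : Fock ι) :
    star ψ ⬝ᵥ (numberProj N *ᵥ ψ) = star (numberProj N *ᵥ ψ) ⬝ᵥ (numberProj N *ᵥ ψ) := by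
  simp only [dotProduct, Pi.star_apply, numberProj_mulVec_apply]
  refine Finset.sum_congr rfl fun s _ => ?_
  split_ifs <;> simp

/-- `P_N` is Hermitian. [folklore] -/
theorem numberProj_isHermitian {ι : Type*} [DecidableEq ι] (N : ℕ) :
    (numberProj N : Matrix (Finset ι) (Finset ι) ℂ).IsHermitian := by
  rw [numberProj, Matrix.IsHermitian, diagonal_conjTranspose]
  congr 1
  funext s
  by_cases h : s.card = N <;> simp [h]

/-- A quadratic form of a Hermitian matrix is real. [folklore] -/
theorem im_dotProduct_mulVec_self_of_isHermitian {ι : Type*} [Fintype ι] {A : Matrix ι ι ℂ}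
    (hA : A.IsHermitian) (x : ι → ℂ) : (star x ⬝ᵥ (A *ᵥ x)).im = 0 := by
  have h : star (star x ⬝ᵥ (A *ᵥ x)) = star x ⬝ᵥ (A *ᵥ x) := by
    conv_lhs => rw [star_dotProduct, star_star, star_mulVec, ← dotProduct_mulVec, hA.eq]
  exact Complex.conj_eq_iff_im.1 h

/-- **`H - Σ_N E_G(N) P_N` is positive semidefinite** (`N` over all sectors `0, …, 2|Λ|`): the
Hubbard Hamiltonian of a graph conserves the particle number, and on the `N`-particle sector it is
bounded below by the sector ground energy. [folklore] -/
theorem posSemidef_hamiltonian_sub_sum_groundEnergyAt_smul_numberProj (G : SimpleGraph Λ) [DecidableRel G.Adj]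
    (t U : ℝ) :
    (hamiltonian G t U - ∑ N ∈ range (Fintype.card (Orb Λ) + 1),
        ((groundEnergyAt G t U N : ℝ) : ℂ) • (numberProj N : Matrix (Finset (Orb Λ)) (Finset (Orb Λ)) ℂ)).PosSemidef := by
  obtain ⟨hH, hHN, -⟩ := hamiltonian_isHermitian_and_commute_holds G t U
  set H := hamiltonian G t U with hHdef
  set R := range (Fintype.card (Orb Λ) + 1) with hR
  have hherm : (H - ∑ N ∈ R, ((groundEnergyAt G t U N : ℝ) : ℂ) •
      (numberProj N : Matrix (Finset (Orb Λ)) (Finset (Orb Λ)) ℂ)).IsHermitian := by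
    refine hH.sub ?_
    rw [Matrix.IsHermitian, conjTranspose_sum]
    refine Finset.sum_congr rfl fun N _ => ?_
    rw [conjTranspose_smul, (numberProj_isHermitian N).eq, Complex.star_def, Complex.conj_ofReal]
  refine Matrix.PosSemidef.of_dotProduct_mulVec_nonneg hherm fun x => ?_
  -- real part `≥ 0`, imaginary part `0`
  have him := im_dotProduct_mulVec_self_of_isHermitian hherm x
  rw [Complex.nonneg_iff]
  refine ⟨?_, him.symm⟩
  -- decompose `x` into sectors
  have hdecomp : star x ⬝ᵥ (H *ᵥ x) = ∑ N ∈ R, star (numberProj N *ᵥ x) ⬝ᵥ (H *ᵥ (numberProj N *ᵥ x)) := by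
    conv_lhs => rw [← sum_numberProj_mulVec x]
    rw [star_sum, sum_dotProduct, mulVec_sum]
    refine Finset.sum_congr rfl fun N _ => ?_
    rw [dotProduct_sum]
    refine Finset.sum_eq_single N (fun M _ hMN => ?_) (fun h => absurd (by assumption) h)
    exact ThermodynamicLimit.dotProduct_eq_zero_of_isNParticle_ne (isNParticle_numberProj_mulVec N x)
      (LiebTwo.isNParticle_mulVec_of_commute (isNParticle_numberProj_mulVec M x) hHN.symm.eq) (Ne.symm hMN)
  have hproj : ∀ N, star x ⬝ᵥ ((((groundEnergyAt G t U N : ℝ) : ℂ) •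
      (numberProj N : Matrix (Finset (Orb Λ)) (Finset (Orb Λ)) ℂ)) *ᵥ x) =
        ((groundEnergyAt G t U N : ℝ) : ℂ) * (star (numberProj N *ᵥ x) ⬝ᵥ (numberProj N *ᵥ x)) := fun N => by
    rw [smul_mulVec, dotProduct_smul, smul_eq_mul, dotProduct_numberProj_mulVec]
  rw [sub_mulVec, dotProduct_sub, hdecomp, Matrix.sum_mulVec, dotProduct_sum, Complex.sub_re, Complex.re_sum,
    Complex.re_sum, ← Finset.sum_sub_distrib]
  refine Finset.sum_nonneg fun N _ => ?_
  rw [hproj, Complex.re_ofReal_mul, sub_nonneg]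
  exact re_dotProduct_hamiltonian_mulVec_ge G t U (isNParticle_numberProj_mulVec N x)

/-- The sector projections resolve the identity: `Σ_{N ≤ |ι|} P_N = 1`. [folklore] -/
theorem sum_range_numberProj {ι : Type*} [DecidableEq ι] [Fintype ι] :
    ∑ N ∈ range (Fintype.card ι + 1), (numberProj N : Matrix (Finset ι) (Finset ι) ℂ) = 1 := by
  refine ext_iff_mulVec.2 fun ψ => ?_
  rw [Matrix.sum_mulVec, sum_numberProj_mulVec, one_mulVec]

/-- The particle number through the sector projections: `Σ_{N ≤ 2|Λ|} N P_N = N_{tot}`. [folklore] -/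
theorem sum_range_smul_numberProj_eq_totalNumber :
    ∑ N ∈ range (Fintype.card (Orb Λ) + 1), ((N : ℂ)) • (numberProj N : Matrix (Finset (Orb Λ)) (Finset (Orb Λ)) ℂ) =
      totalNumber := by
  refine ext_iff_mulVec.2 fun ψ => ?_
  funext s
  rw [totalNumber_eq_diagonal_card, mulVec_diagonal, Matrix.sum_mulVec, Finset.sum_apply]
  simp only [smul_mulVec, Pi.smul_apply, numberProj_mulVec_apply, smul_eq_mul, mul_ite, mul_zero]
  rw [Finset.sum_ite_eq (range (Fintype.card (Orb Λ) + 1)) s.card (fun N => (N : ℂ) * ψ s), if_pos]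
  exact mem_range.mpr (Nat.lt_succ_of_le (Finset.card_le_univ s))

end Finite

/-! ### States: the number distribution and the energy bound -/

namespace InfVolFermionState

variable {d : ℕ} (ω : InfVolFermionState d) (Λ : Finset (Site d))

/-- The number distribution of a state on a region is nonnegative: `Re ω(P_N) ≥ 0`. [folklore] -/
theorem re_expect_numberProj_nonneg (N : ℕ) : 0 ≤ (ω.expect Λ (numberProj N)).re := by
  have hP : (numberProj N : FermionOp Λ) = (numberProj N)ᴴ * numberProj N := by
    rw [(numberProj_isHermitian N).eq, numberProj, diagonal_mul_diagonal]
    congr 1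
    funext s
    split_ifs <;> simp
  rw [hP]
  exact (Complex.nonneg_iff.1 (ω.expect_nonneg Λ _)).1

/-- The number distribution is normalised: `Σ_{N ≤ 2|Λ|} Re ω(P_N) = 1`. [folklore] -/
theorem sum_re_expect_numberProj :
    ∑ N ∈ range (Fintype.card (Orb (PolySite Λ)) + 1), (ω.expect Λ (numberProj N)).re = 1 := by
  rw [← Complex.re_sum, ← map_sum, sum_range_numberProj, ω.expect_one, Complex.one_re]

/-- The mean of the number distribution is the expected particle number:
`Σ_{N ≤ 2|Λ|} N Re ω(P_N) = Re ω(N_Λ)`. [folklore] -/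
theorem sum_mul_re_expect_numberProj :
    ∑ N ∈ range (Fintype.card (Orb (PolySite Λ)) + 1), (N : ℝ) * (ω.expect Λ (numberProj N)).re =
      (ω.expect Λ totalNumber).re := by
  rw [← sum_range_smul_numberProj_eq_totalNumber, map_sum, Complex.re_sum]
  refine Finset.sum_congr rfl fun N _ => ?_
  rw [map_smul, smul_eq_mul, show ((N : ℂ)) = ((N : ℝ) : ℂ) by norm_cast, Complex.re_ofReal_mul]

/-- **The energy of a state is at least the average of the sector ground energies over its number
distribution**: `Σ_{N ≤ 2|Λ|} Re ω(P_N) · E_G(N) ≤ Re ω(hamiltonian G t U)` for every infinite-volume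
state `ω`, every region `Λ` and every graph `G` on the sites of `Λ` (positivity of `ω` on the
positive semidefinite `H - Σ_N E_G(N) P_N`). Ruelle (1969) §2.4. [cite: Ruelle1969, §2.4] -/
theorem sum_re_expect_numberProj_mul_groundEnergyAt_le (G : SimpleGraph (PolySite Λ)) [DecidableRel G.Adj]
    (t U : ℝ) :
    ∑ N ∈ range (Fintype.card (Orb (PolySite Λ)) + 1), (ω.expect Λ (numberProj N)).re * groundEnergyAt G t U N ≤
      (ω.expect Λ (hamiltonian G t U)).re := by
  have h := ω.expect_re_nonneg_of_posSemidef Λ (posSemidef_hamiltonian_sub_sum_groundEnergyAt_smul_numberProj G t U)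
  rw [map_sub, map_sum, Complex.sub_re, Complex.re_sum, sub_nonneg] at h
  refine le_of_eq_of_le ?_ h
  refine Finset.sum_congr rfl fun N _ => ?_
  rw [map_smul, smul_eq_mul, Complex.re_ofReal_mul, mul_comm]

end InfVolFermionState

end Literature.MathematicalPhysics.QuantumLattice

end
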